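import Literature.Geometry.Riemannian.ConjugateHeatPositivity
import Literature.Geometry.Riemannian.RicciFlowScaling
import HarnessLib

/-!
# Perelman's no local collapsing theorem from the solvability of LINEAR parabolic equations
# `∂ₛw = Δ_{h(s)} w + c w` on closed manifolds

`ConjugateHeatPositivity.lean` reduces the named fact `perelman_noLocalCollapsing`
(`CanonicalNeighbourhoods.lean`; Perelman 2002, §4, Thm. 4.1) to the backward solvability of the
conjugate heat equation `□* u = −∂ₜu − Δ_{g(t)}u + Ru = 0` from smooth positive final data along a
Ricci flow (`perelman_noLocalCollapsing_of_conjugateHeat_solvable`). Reversing time,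
`w(s) = u(t₀ − s)` solves the FORWARD linear equation `∂ₛw = Δ_{h(s)} w + c(s) w` for the smooth
family `h(s) = g(t₀ − s)` and the smooth potential `c(s) = −R(t₀ − s)`; so the remaining input is
the textbook existence theorem for linear second-order parabolic equations with smooth
coefficients on a closed manifold (Topping 2006, Rem. 8.2.5: "standard parabolic theory"),
stated here for an arbitrary smooth family of Riemannian metrics and an arbitrary smooth
potential, with no reference to the Ricci flow:

* `perelman_noLocalCollapsing_of_linearParabolic_existence` — **if on every closed manifold
  modelled on `ℝ^m`, for every smooth family of Riemannian metrics `h` on `[0, T]` (`T > 0`,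
  `IsContMDiffFamilyOn ∞ h [0, T]`), every smooth `c` on `M × [0, T]` and every smooth `w₀`, the
  initial value problem `∂ₛw = Δ_{h(s)} w + c w`, `w(0) = w₀` has a smooth solution on `M × [0, T]`,
  then `perelman_noLocalCollapsing` holds.** NOT a discharge of the named fact: this linear
  existence theorem is not in Mathlib or the tree.

Everything is proved (the time reversal: `IsContMDiffFamilyOn.comp_affine`,
`hasDerivWithinAt_time_reverse`); no definition, no named fact.

## References

* P. Topping, *Lectures on the Ricci flow*, LMS Lecture Note Series 325, CUP 2006, §6.4, (6.4.8);
  §8.2, Rem. 8.2.5; §8.3, Thm. 8.3.1. [Topping2006]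
* G. Perelman, *The entropy formula for the Ricci flow and its geometric applications*,
  arXiv:math/0211159 (2002), §3.1; §4, Thm. 4.1. [Perelman2002]
-/

noncomputable section

open Set Function Filter Manifold Bundle MeasureTheory Module
open scoped Manifold ContDiff Topology

namespace Literature.Geometry.Riemannian

open Lorentzian Lorentzian.PseudoRiemannianMetric

universe u v w

/-- **Perelman's no local collapsing theorem I from the existence theory of linear parabolic
equations on closed manifolds** (Perelman 2002, §4, Thm. 4.1; Topping 2006, Rem. 8.2.5, §6.4,
Thm. 8.3.1). Assume
* `hLH`: on every closed manifold `M` modelled on `EuclideanSpace ℝ (Fin m)` (all `m`), for every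
  `T > 0`, every family `h` of Riemannian metrics smooth on `M × [0, T]`
  (`IsContMDiffFamilyOn ∞ h (Icc 0 T)`), every `c : ℝ → M → ℝ` smooth on `M × [0, T]` and every
  smooth `w₀ : M → ℝ`, there is `w` smooth on `M × [0, T]` with `w(0) = w₀` and
  `∂ₛw = Δ_{h(s)} w(s) + c(s) w(s)` at every `(x, s) ∈ M × [0, T]` (`∂ₛ` the one-sided `derivWithin`
  in `[0, T]`, `Δ = laplaceBeltrami`).
Then `perelman_noLocalCollapsing` holds (every model space): for a Ricci flow `(g, cov)` on
`[0, T)` and `0 < t₀ < T`, the solution `w` for `h(s) = g(t₀ − s)`, `c(s) = −R(t₀ − s)`, `w₀ = u₁`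
gives the conjugate heat solution `u(t) = w(t₀ − t)` with `u(t₀) = u₁` required by
`perelman_noLocalCollapsing_of_conjugateHeat_solvable`. NOT a discharge of the named fact.
[cite: Perelman2002, §4, Thm. 4.1] [cite: Topping2006, §8.2, Rem. 8.2.5; §8.3, Thm. 8.3.1] -/
theorem perelman_noLocalCollapsing_of_linearParabolic_existence
    (hLH : ∀ (m : ℕ) {H : Type v} [TopologicalSpace H]
      (I : ModelWithCorners ℝ (EuclideanSpace ℝ (Fin m)) H) [I.Boundaryless]
      (M : Type w) [TopologicalSpace M] [T2Space M] [SecondCountableTopology M] [CompactSpace M]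
      [ChartedSpace H M] [IsManifold I ∞ M] (T : ℝ), 0 < T →
      ∀ (h : ℝ → PseudoRiemannianMetric I ∞ (EuclideanSpace ℝ (Fin m)) (TangentSpace I : M → Type _)),
        IsContMDiffFamilyOn ∞ h (Icc 0 T) → (∀ s ∈ Icc 0 T, (h s).IsRiemannian) →
        ∀ c : ℝ → M → ℝ,
          ContMDiffOn (I.prod 𝓘(ℝ, ℝ)) 𝓘(ℝ, ℝ) ∞ (fun p : M × ℝ ↦ c p.2 p.1) (univ ×ˢ Icc 0 T) →
        ∀ w₀ : M → ℝ, ContMDiff I 𝓘(ℝ, ℝ) ∞ w₀ →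
          ∃ w : ℝ → M → ℝ, w 0 = w₀ ∧
            ContMDiffOn (I.prod 𝓘(ℝ, ℝ)) 𝓘(ℝ, ℝ) ∞ (fun p : M × ℝ ↦ w p.2 p.1) (univ ×ˢ Icc 0 T) ∧
            ∀ s ∈ Icc 0 T, ∀ x, derivWithin (fun r ↦ w r x) (Icc 0 T) s =
              (h s).laplaceBeltrami (w s) x + c s x * w s x) :
    perelman_noLocalCollapsing.{u, v, w} := by
  refine perelman_noLocalCollapsing_of_conjugateHeat_solvable
    fun m _H _ I _ M _ _ _ _ _ _ _ _ T hT g cov hflow hRiem t₀ ht₀ u₁ hu₁ _hu₁p ↦ ?_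
  have hflow' : IsRicciFlow g cov (Icc 0 t₀) :=
    hflow.mono fun s hs ↦ ⟨hs.1, hs.2.trans_lt ht₀.2⟩
  have hmaps : ∀ s ∈ Icc (0 : ℝ) t₀, t₀ - s ∈ Icc (0 : ℝ) t₀ := fun s hs ↦
    ⟨by linarith [hs.2], by linarith [hs.1]⟩
  -- the time reversal `(x, s) ↦ (x, t₀ - s)` of `M × ℝ`
  have hρ : ContMDiff (I.prod 𝓘(ℝ, ℝ)) (I.prod 𝓘(ℝ, ℝ)) ∞ (fun p : M × ℝ ↦ (p.1, t₀ - p.2)) :=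
    contMDiff_fst.prodMk ((contDiff_const.sub contDiff_id).contMDiff.comp contMDiff_snd)
  have hρmaps : MapsTo (fun p : M × ℝ ↦ (p.1, t₀ - p.2)) (univ ×ˢ Icc (0 : ℝ) t₀)
      (univ ×ˢ Icc (0 : ℝ) t₀) := fun p hp ↦ ⟨mem_univ _, hmaps p.2 hp.2⟩
  -- the reversed family `h(s) = g(t₀ - s)` is smooth on `M × [0, t₀]` and Riemannian
  have hfam : IsContMDiffFamilyOn ∞ (fun s ↦ g (t₀ - s)) (Icc 0 t₀) := by
    have h1 := hflow'.smooth.comp_affine (-1) t₀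
    have hset : (fun t : ℝ ↦ (-1) * t + t₀) ⁻¹' Icc 0 t₀ = Icc 0 t₀ := by
      ext s
      simp only [mem_preimage, mem_Icc]
      constructor <;> rintro ⟨h₁, h₂⟩ <;> constructor <;> linarith
    have hfun : (fun s : ℝ ↦ g ((-1) * s + t₀)) = fun s ↦ g (t₀ - s) := by
      funext s
      congr 1
      ring
    rw [hset, hfun] at h1
    exact h1
  have hRiem' : ∀ s ∈ Icc 0 t₀, (g (t₀ - s)).IsRiemannian := fun s hs ↦
    hRiem _ ⟨(hmaps s hs).1, (hmaps s hs).2.trans_lt ht₀.2⟩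
  -- the potential `c(s) = -R(t₀ - s)` is smooth on `M × [0, t₀]`
  have hc : ContMDiffOn (I.prod 𝓘(ℝ, ℝ)) 𝓘(ℝ, ℝ) ∞ (fun p : M × ℝ ↦
      (fun (s : ℝ) (x : M) ↦ -(g (t₀ - s)).scalarCurvatureWith (cov (t₀ - s)) x) p.2 p.1)
      (univ ×ˢ Icc 0 t₀) :=
    (hflow'.contMDiffOn_scalarCurvatureWith.comp hρ.contMDiffOn hρmaps).neg
  -- solve the forward linear equation from `u₁`
  obtain ⟨w, hw0, hw, hwpde⟩ := hLH m I M t₀ ht₀.1 (fun s ↦ g (t₀ - s)) hfam hRiem'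
    (fun (s : ℝ) (x : M) ↦ -(g (t₀ - s)).scalarCurvatureWith (cov (t₀ - s)) x) hc u₁ hu₁
  refine ⟨fun t x ↦ w (t₀ - t) x, ?_, ?_, ?_⟩
  · funext x
    simp only [sub_self, hw0]
  · exact hw.comp hρ.contMDiffOn hρmaps
  · intro t ht x
    have hd := hasDerivWithinAt_time (n := ∞) (by simp) hw x (hmaps t ht)
    rw [hwpde (t₀ - t) (hmaps t ht) x] at hd
    have hrev := hasDerivWithinAt_time_reverse (T' := t₀) (s := t) hd
    rw [hrev.derivWithin (uniqueDiffOn_Icc ht₀.1 t ht)]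
    simp only [sub_sub_cancel]
    ring

end Literature.Geometry.Riemannian

end
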